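import Summits.HodgeConjecture.CorCM.PairFlipSexticTimesReflexOcticHodge
import HarnessLib

/-!
# The REFLEX TYPE of a pair-flip sextic CM type is DEGENERATE of rank `4`, yet `T × T^{reflex}` is ADDITIVE

COR-CM (cell `pub-hodgecm2`, binder seat `b16` gen 45, count-neutral claim REFLEX-OCTIC-34, file F7); NEW as stated (kernel
form of one half of Dodson 1984 §3.3.2 Theorem: "a simple abelian variety of CM-type `(K, Φ)` of dimension `4` is
degenerate iff `Gal(K^c/ℚ) = ℤ₂ × 𝔄₄`, or `ℤ₂ × 𝔖₄` and `(K, Φ)` is the reflex of a type on a CM-field of degree `6`"),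
hence under `Summits/`.  Theorems only; no definition, no named fact, no `sorry`.

Setting of `PairFlipSexticTimesReflexOcticHodge`: `K_{i₀}` sextic with pair flips, type `Φ_T`; `K_{i₁}` with an embedding
`ψ₀` whose fixer is `Stab(Φ_T)` (`ψ₀(K_{i₁})` = the reflex field `K*`); `Hom(K_{i₁}, ℂ) = {σψ₀}` ≅ the eight types `σΦ_T`
(a cube).  For `x ∈ Φ_T` the FACE TYPE at `x` is the type `Ψ` of `K_{i₁}` with `σψ₀ ∈ Ψ ⟺ x ∈ σΦ_T` — the four
embeddings whose attached type CONTAINS `x`.  By Shimura's construction this is the REFLEX TYPE of `(K_{i₀}, Φ_T)` taken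
with respect to the base embedding `x` and transported to `K_{i₁}` along `ψ₀` (`Φ* = {σ⁻¹|_{K*} : σ ∘ x ∈ Φ_T}`, and
`σ⁻¹ψ₀ ↦ σ⁻¹Φ_T ∋ x ⟺ σx ∈ Φ_T`).

* abstract (`ReflexSlot`, cube setting of `PairFlipSexticReflexSlotCube`): `antiSpan_face_le` — `U(face_{x₁}) ⊆
  span{sgn_{x₁}, sgn_{x₂}, sgn_{x₃}}` (the translates of `sgn_{x₁}` are the `±sgn_{x_i}`), and EQUALITY with the three
  sign functions independent (`finrank_antiSpan_face`: `dim U = 3`), so `typeRank_face : rank(face) = 4` — DEGENERATE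
  (`< 8/2 + 1 = 5`), defect `1`;
* number fields: **`cmTypeRank_eq_four_of_reflexType`** (`rank(Ψ) = 4`; `not_isNondegenerate_of_reflexType`: the reflex
  CM fourfold `T*` of a pair-flip CM threefold is DEGENERATE — exceptional Hodge classes on some power of `T*`), and
  **`cmFamilyRank_eq_seven_of_reflexType`** (`rank(Φ_T, Ψ) = 7 = 1 + (4 − 1) + (4 − 1)`: the face type is not a Hamming
  ball — `ψ₀ ∈ Ψ` but the flip-neighbour `σ_xψ₀ ∉ Ψ` — so `PairFlipSexticTimesReflexOcticHodge` gives ADDITIVITY,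
  `Hg(T × T*) = Hg(T) × Hg(T*)`: the pairing creates no exceptional classes beyond those of the powers of `T*`).

## References

* [Dodson1984] B. Dodson, *The structure of Galois groups of CM-fields*, Trans. AMS 283 (1984), §3.3.2 (Theorem) and
  Prop. 5.2.2.
* [Shimura1998] G. Shimura, *Abelian Varieties with Complex Multiplication and Modular Functions*, §8.3 (reflex type),
  Prop. 28.
* [Gordon1999HodgeAVSurvey] B. B. Gordon, *A survey of the Hodge conjecture for abelian varieties*, 7.5–7.7.
-/

set_option autoImplicit false

noncomputable section

open scoped BigOperators Classical

namespace Summit.HodgeConjecture.CorCM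

namespace ReflexSlot

open Literature.NumberTheory.ComplexMultiplication

variable {G : Type*} [Group G] {Z Y : Type*} [MulAction G Z] [MulAction G Y] {ρ : G} {Φ₀ : Set Z}
  {T : Y → Set Z} {y₀ : Y} {x₁ x₂ x₃ : Z} {φ₁ φ₂ φ₃ : G}

/-! ### §1 The face type `{y : x₁ ∈ T y}` -/

/-- **The face `{y : x ∈ T y}` is a CM type for `ρ` on `Y`.** [cite: Shimura1998, §8.3 Prop. 28] -/
theorem isCMTypeWith_face (hΦ : IsCMTypeWith ρ Φ₀)
    (hT : ∀ (g : G) (y : Y) (x : Z), x ∈ T (g • y) ↔ g⁻¹ • x ∈ T y) (hTi : Function.Injective T)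
    (hT₀ : T y₀ = Φ₀) (hY : ∀ y : Y, ∃ g : G, g • y₀ = y) (x : Z) : IsCMTypeWith ρ {y : Y | x ∈ T y} :=
  isCMTypeWith_of_mem_iff hΦ hT hTi fun y => by
    simp only [Set.mem_setOf_eq, mem_typeMap_rho_smul_iff hΦ hT hT₀ hY, not_not]

/-- The translates of the sign vector of the face at `x`: `u_g(face_x) = sgn_{g⁻¹x}`. [cite: Shimura1998, §8.3] -/
theorem antiVec_face (hT : ∀ (g : G) (y : Y) (x : Z), x ∈ T (g • y) ↔ g⁻¹ • x ∈ T y) (x : Z) (g : G) :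
    antiVec {y : Y | x ∈ T y} g = fun y => if g⁻¹ • x ∈ T y then (1 : ℚ) else -1 := by
  funext y
  simp only [antiVec, translateInd, Set.mem_setOf_eq, hT]
  split_ifs <;> norm_num

/-- `sgn_{ρz} = −sgn_z`. [cite: Shimura1998, §8.3 Prop. 28] -/
theorem sign_rho_smul (hΦ : IsCMTypeWith ρ Φ₀)
    (hT : ∀ (g : G) (y : Y) (x : Z), x ∈ T (g • y) ↔ g⁻¹ • x ∈ T y) (hT₀ : T y₀ = Φ₀)
    (hY : ∀ y : Y, ∃ g : G, g • y₀ = y) (z : Z) :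
    (fun y => if ρ • z ∈ T y then (1 : ℚ) else -1) = -fun y => if z ∈ T y then (1 : ℚ) else -1 := by
  funext y
  simp only [Pi.neg_apply, rho_smul_mem_typeMap_iff hΦ hT hT₀ hY]
  split_ifs <;> norm_num

/-- **`U(face_{x₁}) ≤ span{sgn_{x₁}, sgn_{x₂}, sgn_{x₃}}`** (every translate is `±sgn_{x_i}`): the reflex type has
rank at most `4`. [cite: Dodson1984, §3.3.2] -/
theorem antiSpan_face_le (hΦ : IsCMTypeWith ρ Φ₀)
    (hT : ∀ (g : G) (y : Y) (x : Z), x ∈ T (g • y) ↔ g⁻¹ • x ∈ T y) (hT₀ : T y₀ = Φ₀)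
    (hY : ∀ y : Y, ∃ g : G, g • y₀ = y) (hx : Φ₀ = {x₁, x₂, x₃}) :
    antiSpan G {y : Y | x₁ ∈ T y} ≤ Submodule.span ℚ
      {(fun y => if x₁ ∈ T y then (1 : ℚ) else -1), (fun y => if x₂ ∈ T y then (1 : ℚ) else -1),
        (fun y => if x₃ ∈ T y then (1 : ℚ) else -1)} := by
  rw [antiSpan, Submodule.span_le]
  rintro _ ⟨g, rfl⟩
  rw [SetLike.mem_coe]
  change antiVec {y : Y | x₁ ∈ T y} g ∈ _
  rw [antiVec_face hT]
  set W := Submodule.span ℚ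
      {(fun y => if x₁ ∈ T y then (1 : ℚ) else -1), (fun y => if x₂ ∈ T y then (1 : ℚ) else -1),
        (fun y => if x₃ ∈ T y then (1 : ℚ) else -1)} with hW
  have m₁ : (fun y => if x₁ ∈ T y then (1 : ℚ) else -1) ∈ W := Submodule.subset_span (by simp)
  have m₂ : (fun y => if x₂ ∈ T y then (1 : ℚ) else -1) ∈ W := Submodule.subset_span (by simp)
  have m₃ : (fun y => if x₃ ∈ T y then (1 : ℚ) else -1) ∈ W := Submodule.subset_span (by simp)
  change (fun y => if g⁻¹ • x₁ ∈ T y then (1 : ℚ) else -1) ∈ W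
  rcases eq_or_eq_rho_smul_of_triple hΦ hx (g⁻¹ • x₁) with (h | h | h) | (h | h | h) <;> rw [h]
  · exact m₁
  · exact m₂
  · exact m₃
  · rw [sign_rho_smul hΦ hT hT₀ hY]; exact W.neg_mem m₁
  · rw [sign_rho_smul hΦ hT hT₀ hY]; exact W.neg_mem m₂
  · rw [sign_rho_smul hΦ hT hT₀ hY]; exact W.neg_mem m₃

/-- Conversely every `sgn_{x_i}` is a translate of `sgn_{x₁}` (transitivity on `Z`), so
**`U(face_{x₁}) = span{sgn_{x₁}, sgn_{x₂}, sgn_{x₃}}`**. [cite: Dodson1984, §3.3.2] -/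
theorem antiSpan_face_eq [MulAction.IsPretransitive G Z] (hΦ : IsCMTypeWith ρ Φ₀)
    (hT : ∀ (g : G) (y : Y) (x : Z), x ∈ T (g • y) ↔ g⁻¹ • x ∈ T y) (hT₀ : T y₀ = Φ₀)
    (hY : ∀ y : Y, ∃ g : G, g • y₀ = y) (hx : Φ₀ = {x₁, x₂, x₃}) :
    antiSpan G {y : Y | x₁ ∈ T y} = Submodule.span ℚ
      {(fun y => if x₁ ∈ T y then (1 : ℚ) else -1), (fun y => if x₂ ∈ T y then (1 : ℚ) else -1),
        (fun y => if x₃ ∈ T y then (1 : ℚ) else -1)} := by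
  refine le_antisymm (antiSpan_face_le hΦ hT hT₀ hY hx) (Submodule.span_le.2 ?_)
  have gen : ∀ z : Z, (fun y => if z ∈ T y then (1 : ℚ) else -1) ∈ antiSpan G {y : Y | x₁ ∈ T y} := by
    intro z
    obtain ⟨g, hg⟩ := MulAction.exists_smul_eq G z x₁
    have hg' : g⁻¹ • x₁ = z := by rw [inv_smul_eq_iff, hg]
    have h1 : antiVec {y : Y | x₁ ∈ T y} g = fun y => if z ∈ T y then (1 : ℚ) else -1 := by
      rw [antiVec_face hT, hg']
    rw [← h1]
    exact Submodule.subset_span ⟨g, rfl⟩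
  intro f hf
  simp only [Set.mem_insert_iff, Set.mem_singleton_iff] at hf
  rcases hf with rfl | rfl | rfl
  · exact gen x₁
  · exact gen x₂
  · exact gen x₃

/-- **The three sign functions are linearly independent** (evaluate at `y₀, φ₂y₀, φ₃y₀`), so `dim U(face_{x₁}) = 3`.
[cite: Dodson1984, §3.3.2] -/
theorem finrank_antiSpan_face [MulAction.IsPretransitive G Z] (hΦ : IsCMTypeWith ρ Φ₀)
    (hT : ∀ (g : G) (y : Y) (x : Z), x ∈ T (g • y) ↔ g⁻¹ • x ∈ T y) (hT₀ : T y₀ = Φ₀)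
    (hY : ∀ y : Y, ∃ g : G, g • y₀ = y) (hx : Φ₀ = {x₁, x₂, x₃}) (h12 : x₁ ≠ x₂) (h13 : x₁ ≠ x₃)
    (h23 : x₂ ≠ x₃)
    (hφ₂ : φ₂ • x₂ = ρ • x₂ ∧ ∀ z : Z, z ≠ x₂ → z ≠ ρ • x₂ → φ₂ • z = z)
    (hφ₃ : φ₃ • x₃ = ρ • x₃ ∧ ∀ z : Z, z ≠ x₃ → z ≠ ρ • x₃ → φ₃ • z = z) :
    Module.finrank ℚ (antiSpan G {y : Y | x₁ ∈ T y}) = 3 := by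
  obtain ⟨m₁, m₂, m₃⟩ := mem_of_eq_triple hx
  have b₁ : x₁ ∈ T y₀ := by rw [hT₀]; exact m₁
  have b₂ : x₂ ∈ T y₀ := by rw [hT₀]; exact m₂
  have b₃ : x₃ ∈ T y₀ := by rw [hT₀]; exact m₃
  have c₂ := mem_typeMap_pairFlip_smul hΦ hT hT₀ hY hx h12 h23 hφ₂
  have hx' : Φ₀ = {x₁, x₃, x₂} := by rw [hx, Set.pair_comm x₂ x₃]
  have c₃ := mem_typeMap_pairFlip_smul hΦ hT hT₀ hY hx' h13 h23.symm hφ₃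
  set s₁ : Y → ℚ := fun y => if x₁ ∈ T y then (1 : ℚ) else -1 with hs₁
  set s₂ : Y → ℚ := fun y => if x₂ ∈ T y then (1 : ℚ) else -1 with hs₂
  set s₃ : Y → ℚ := fun y => if x₃ ∈ T y then (1 : ℚ) else -1 with hs₃
  -- linear independence of `![s₁, s₂, s₃]`
  have hli : LinearIndependent ℚ ![s₁, s₂, s₃] := by
    rw [Fintype.linearIndependent_iff]
    intro c hc i
    have e₀ := congrFun hc y₀
    have e₂ := congrFun hc (φ₂ • y₀)
    have e₃ := congrFun hc (φ₃ • y₀)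
    simp only [Fin.sum_univ_three, Matrix.cons_val_zero, Matrix.cons_val_one, Matrix.cons_val_two,
      Matrix.tail_cons, Matrix.head_cons, Pi.add_apply, Pi.smul_apply, Pi.zero_apply, smul_eq_mul, hs₁, hs₂, hs₃,
      b₁, b₂, b₃, (c₂ y₀).1, (c₂ y₀).2.1, (c₂ y₀).2.2, (c₃ y₀).1, (c₃ y₀).2.1, (c₃ y₀).2.2, if_true, if_false,
      not_true_eq_false] at e₀ e₂ e₃
    fin_cases i <;> (try simp only [Fin.isValue, Fin.mk_one, Fin.reduceFinMk]) <;> linarith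
  rw [antiSpan_face_eq hΦ hT hT₀ hY hx]
  have hrange : ({s₁, s₂, s₃} : Set (Y → ℚ)) = Set.range ![s₁, s₂, s₃] := by
    ext f
    simp only [Set.mem_insert_iff, Set.mem_singleton_iff, Set.mem_range]
    constructor
    · rintro (rfl | rfl | rfl)
      · exact ⟨0, rfl⟩
      · exact ⟨1, rfl⟩
      · exact ⟨2, rfl⟩
    · rintro ⟨i, rfl⟩
      fin_cases i <;> simp
  rw [hrange, finrank_span_eq_card hli, Fintype.card_fin]

variable [Fintype Y]

/-- **The face type has rank `4`**: DEGENERATE (`4 < 8/2 + 1`), defect `1` — the reflex type of a pair-flip sextic type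
(Dodson: the degenerate simple CM fourfolds with group `ℤ₂ × 𝔖₄` are exactly these). [cite: Dodson1984, §3.3.2] -/
theorem typeRank_face [MulAction.IsPretransitive G Z] (hΦ : IsCMTypeWith ρ Φ₀)
    (hT : ∀ (g : G) (y : Y) (x : Z), x ∈ T (g • y) ↔ g⁻¹ • x ∈ T y) (hTi : Function.Injective T)
    (hT₀ : T y₀ = Φ₀) (hY : ∀ y : Y, ∃ g : G, g • y₀ = y) (hx : Φ₀ = {x₁, x₂, x₃}) (h12 : x₁ ≠ x₂)
    (h13 : x₁ ≠ x₃) (h23 : x₂ ≠ x₃)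
    (hφ₂ : φ₂ • x₂ = ρ • x₂ ∧ ∀ z : Z, z ≠ x₂ → z ≠ ρ • x₂ → φ₂ • z = z)
    (hφ₃ : φ₃ • x₃ = ρ • x₃ ∧ ∀ z : Z, z ≠ x₃ → z ≠ ρ • x₃ → φ₃ • z = z) :
    typeRank G {y : Y | x₁ ∈ T y} = 4 := by
  haveI : Nonempty Y := ⟨y₀⟩
  rw [(isCMTypeWith_face hΦ hT hTi hT₀ hY x₁).typeRank_eq_finrank_antiSpan_add_one,
    finrank_antiSpan_face hΦ hT hT₀ hY hx h12 h13 h23 hφ₂ hφ₃]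

end ReflexSlot

/-! ### §2 Number fields: the reflex type of a pair-flip sextic type -/

section Types

open NumberField Module
open Literature.NumberTheory.ComplexMultiplication
open Literature.AlgebraicGeometry.Motives (CMType)
open Literature.AlgebraicGeometry.Pohlmann1968

variable {I : Type} {K : I → Type} [∀ i, Field (K i)] [∀ i, NumberField (K i)] [∀ i, IsCMField (K i)] [Fintype I]

omit [∀ i, NumberField (K i)] [∀ i, IsCMField (K i)] [Fintype I] in
/-- Relabelling a three-element type so that a given member comes first. [folklore] -/
theorem exists_eq_triple_of_mem {i : I} {S : Set (K i →+* ℂ)} {x x₁ x₂ x₃ : K i →+* ℂ} (hS : S = {x₁, x₂, x₃})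
    (h12 : x₁ ≠ x₂) (h13 : x₁ ≠ x₃) (h23 : x₂ ≠ x₃) (hx : x ∈ S) :
    ∃ a b : K i →+* ℂ, S = {x, a, b} ∧ x ≠ a ∧ x ≠ b ∧ a ≠ b ∧ (a = x₁ ∨ a = x₂ ∨ a = x₃) ∧
      (b = x₁ ∨ b = x₂ ∨ b = x₃) := by
  rw [hS] at hx
  simp only [Set.mem_insert_iff, Set.mem_singleton_iff] at hx
  rcases hx with h | h | h
  · refine ⟨x₂, x₃, ?_, ?_, ?_, h23, Or.inr (Or.inl rfl), Or.inr (Or.inr rfl)⟩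
    · rw [hS, h]
    · rw [h]; exact h12
    · rw [h]; exact h13
  · refine ⟨x₁, x₃, ?_, ?_, ?_, h13, Or.inl rfl, Or.inr (Or.inr rfl)⟩
    · rw [hS, h, Set.insert_comm]
    · rw [h]; exact Ne.symm h12
    · rw [h]; exact h23
  · refine ⟨x₁, x₂, ?_, ?_, ?_, h12, Or.inl rfl, Or.inr (Or.inl rfl)⟩
    · rw [hS, h, Set.insert_comm x₁ x₂, Set.pair_comm x₁ x₃, Set.insert_comm x₂ x₃, Set.pair_comm x₂ x₁]
    · rw [h]; exact Ne.symm h13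
    · rw [h]; exact Ne.symm h23

omit [Fintype I] in
/-- **The reflex type of a pair-flip sextic type has rank `4`.**  `K_{i₀}` sextic with pair flips, type `Φ_T`, `ψ₀`
an embedding of `K_{i₁}` with `Fix(ψ₀) = Stab(Φ_T)`, `x ∈ Φ_T`; if `Φ_{i₁}` is the FACE TYPE at `x` — `σψ₀ ∈ Φ_{i₁}
⟺ x ∈ σΦ_T` (the reflex type of `(K_{i₀}, Φ_T)` w.r.t. the base embedding `x`, on `K_{i₁}` via `ψ₀`) — then
`rank(Φ_{i₁}) = 4`. [cite: Dodson1984, §3.3.2] [cite: Shimura1998, §8.3] -/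
theorem cmTypeRank_eq_four_of_reflexType {i₀ i₁ : I} (h6 : finrank ℚ (K i₀) = 6)
    (hflip : ∀ s : K i₀ →+* ℂ, ∃ σ : ℂ ≃+* ℂ, σ • s = (starRingAut : ℂ ≃+* ℂ) • s ∧
      ∀ t : K i₀ →+* ℂ, t ≠ s → t ≠ (starRingAut : ℂ ≃+* ℂ) • s → σ • t = t)
    (Φ : ∀ i, CMType (K i)) {ψ₀ : K i₁ →+* ℂ}
    (hψ₀ : ∀ σ : ℂ ≃+* ℂ, σ • ψ₀ = ψ₀ ↔ ∀ x : K i₀ →+* ℂ, σ • x ∈ (Φ i₀).1 ↔ x ∈ (Φ i₀).1)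
    {x : K i₀ →+* ℂ} (hxΦ : x ∈ (Φ i₀).1)
    (hface : ∀ (σ : ℂ ≃+* ℂ), σ • ψ₀ ∈ (Φ i₁).1 ↔ σ⁻¹ • x ∈ (Φ i₀).1) :
    cmTypeRank (Φ i₁) = 4 := by
  obtain ⟨T, x₁, x₂, x₃, φ₁, φ₂, φ₃, hT, hTi, hT₀, hY, hx, h12, h13, h23, hφ₁, hφ₂, hφ₃⟩ :=
    exists_reflexSlot_data h6 hflip Φ hψ₀
  haveI := isPretransitive_ringEquiv_complex (K := K i₀)
  -- `Φ_{i₁}` is the face `{ψ | x ∈ T ψ}`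
  have hΨ : (Φ i₁).1 = {ψ : K i₁ →+* ℂ | x ∈ T ψ} := by
    ext ψ
    obtain ⟨σ, rfl⟩ := hY ψ
    rw [Set.mem_setOf_eq, hT, hT₀]
    exact hface σ
  -- relabel so that `x` comes first
  obtain ⟨a, b, hx', hxa, hxb, hab, ha, hb⟩ := exists_eq_triple_of_mem hx h12 h13 h23 hxΦ
  have hφa : ∃ φ : ℂ ≃+* ℂ, φ • a = (starRingAut : ℂ ≃+* ℂ) • a ∧
      ∀ z : K i₀ →+* ℂ, z ≠ a → z ≠ (starRingAut : ℂ ≃+* ℂ) • a → φ • z = z := by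
    rcases ha with rfl | rfl | rfl
    · exact ⟨φ₁, hφ₁⟩
    · exact ⟨φ₂, hφ₂⟩
    · exact ⟨φ₃, hφ₃⟩
  have hφb : ∃ φ : ℂ ≃+* ℂ, φ • b = (starRingAut : ℂ ≃+* ℂ) • b ∧
      ∀ z : K i₀ →+* ℂ, z ≠ b → z ≠ (starRingAut : ℂ ≃+* ℂ) • b → φ • z = z := by
    rcases hb with rfl | rfl | rfl
    · exact ⟨φ₁, hφ₁⟩
    · exact ⟨φ₂, hφ₂⟩
    · exact ⟨φ₃, hφ₃⟩
  obtain ⟨φa, hφa⟩ := hφa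
  obtain ⟨φb, hφb⟩ := hφb
  change typeRank (ℂ ≃+* ℂ) (Φ i₁).1 = 4
  rw [hΨ]
  exact ReflexSlot.typeRank_face (isCMTypeWith_conj (Φ i₀)) hT hTi hT₀ hY hx' hxa hxb hab hφa hφb

omit [Fintype I] in
/-- **The reflex type of a pair-flip sextic type is DEGENERATE** (`rank 4 < 5`): its CM abelian fourfolds `T*` carry
exceptional Hodge classes on some power — the "reflex of a type on a CM-field of degree `6`" case of Dodson's list of
degenerate simple CM fourfolds. [cite: Dodson1984, §3.3.2] -/
theorem not_isNondegenerate_of_reflexType {i₀ i₁ : I} (h6 : finrank ℚ (K i₀) = 6)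
    (hflip : ∀ s : K i₀ →+* ℂ, ∃ σ : ℂ ≃+* ℂ, σ • s = (starRingAut : ℂ ≃+* ℂ) • s ∧
      ∀ t : K i₀ →+* ℂ, t ≠ s → t ≠ (starRingAut : ℂ ≃+* ℂ) • s → σ • t = t)
    (Φ : ∀ i, CMType (K i)) {ψ₀ : K i₁ →+* ℂ}
    (hψ₀ : ∀ σ : ℂ ≃+* ℂ, σ • ψ₀ = ψ₀ ↔ ∀ x : K i₀ →+* ℂ, σ • x ∈ (Φ i₀).1 ↔ x ∈ (Φ i₀).1)
    {x : K i₀ →+* ℂ} (hxΦ : x ∈ (Φ i₀).1)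
    (hface : ∀ (σ : ℂ ≃+* ℂ), σ • ψ₀ ∈ (Φ i₁).1 ↔ σ⁻¹ • x ∈ (Φ i₀).1) :
    ¬ IsNondegenerate (Φ i₁) := by
  rw [isNondegenerate_iff, cmTypeRank_eq_four_of_reflexType h6 hflip Φ hψ₀ hxΦ hface,
    finrank_eq_eight_of_reflexOctic h6 hflip Φ hψ₀]
  norm_num

/-- **`T × T*` is ADDITIVE**: for the face (= reflex) type `Φ_{i₁}` at `x ∈ Φ_T`, `rank(Φ_T, Φ_{i₁}) = 7 =
rank(Φ_{i₁}) + 3` — `Hg(T × T*) = Hg(T) × Hg(T*)` (dimensions `3 + 3`): the face type is not a Hamming ball (`ψ₀`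
lies in it, the flip-neighbour at `x` does not). [cite: Dodson1984, §3.3.2] [cite: Gordon1999HodgeAVSurvey, 7.5–7.7] -/
theorem cmFamilyRank_eq_seven_of_reflexType {i₀ i₁ : I} (h01 : i₀ ≠ i₁) (hI : ∀ j, j = i₀ ∨ j = i₁)
    (h6 : finrank ℚ (K i₀) = 6)
    (hflip : ∀ s : K i₀ →+* ℂ, ∃ σ : ℂ ≃+* ℂ, σ • s = (starRingAut : ℂ ≃+* ℂ) • s ∧
      ∀ t : K i₀ →+* ℂ, t ≠ s → t ≠ (starRingAut : ℂ ≃+* ℂ) • s → σ • t = t)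
    (Φ : ∀ i, CMType (K i)) {ψ₀ : K i₁ →+* ℂ}
    (hψ₀ : ∀ σ : ℂ ≃+* ℂ, σ • ψ₀ = ψ₀ ↔ ∀ x : K i₀ →+* ℂ, σ • x ∈ (Φ i₀).1 ↔ x ∈ (Φ i₀).1)
    {x : K i₀ →+* ℂ} (hxΦ : x ∈ (Φ i₀).1)
    (hface : ∀ (σ : ℂ ≃+* ℂ), σ • ψ₀ ∈ (Φ i₁).1 ↔ σ⁻¹ • x ∈ (Φ i₀).1) :
    CMAlgebra.cmFamilyRank Φ = 7 := by
  have hΦ := isCMTypeWith_conj (Φ i₀)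
  -- `ψ₀ ∈ Φ_{i₁}` and the flip-neighbour at `x` is not
  have h0 : ψ₀ ∈ (Φ i₁).1 := by
    have h1 := hface 1
    rw [one_smul, inv_one, one_smul] at h1
    exact h1.2 hxΦ
  obtain ⟨σ, hσ, hσ'⟩ := hflip x
  have hσψ : σ • ψ₀ ∉ (Φ i₁).1 := by
    rw [hface]
    have h1 : σ⁻¹ • x = (starRingAut : ℂ ≃+* ℂ) • x := by
      rw [inv_smul_eq_iff, ReflexSlot.smul_rho_eq_of_pairFlip hΦ hσ]
    rw [h1]
    exact (hΦ.mem_iff x).1 hxΦ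
  rw [cmFamilyRank_eq_add_three_of_reflexOctic h01 hI h6 hflip Φ hψ₀ (fun hb => hσψ (hb.2 x σ hxΦ hσ hσ'))
    (fun hb => hb.1 h0), cmTypeRank_eq_four_of_reflexType h6 hflip Φ hψ₀ hxΦ hface]

end Types

end Summit.HodgeConjecture.CorCM

end
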